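import Summits.HodgeConjecture.HodgeConjecture.Theorems.F0P2oK1wOfWeylConj          -- ★ `quotConj_units_map`, `halfModulusChar_units_map_of_involutive`
import Literature.NumberTheory.Rogawski1990.XiLocalCharacter                       -- ★ `OneDimAutRepH.xiLocalChar`, `xiLocalChar_apply_eq`, `localDet`
import Literature.NumberTheory.Automorphic.UnitaryGroupLineBorelModulus             -- ★ `rootDeltaChar_cmBorel_torus_two` (`δ_{B₂}^{1∕2}(t) = ‖t₀₀‖^{1∕2}`)
import Literature.NumberTheory.Automorphic.UnitaryGroupLineUnipotentRing            -- ★ `LineRing.torus_relations_two`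
import Literature.NumberTheory.Automorphic.UnitaryGroupPrincipalSeriesExponents     -- ★ `weylTorusCharPair` (`wχ = (χ̄₁⁻¹, χ₂)`)
import HarnessLib

/-!
# F0 · P3c · line LH6 «StCharTS» — road (D) «DEEP-FL», (D-c)(δ₂) «XI-ON-TORUS»: `ξ_v|_{T_H} = ψ_v∘det · δ_{B₂}^{1∕2} · w(χ_{H,2})` — the one-dimensional
# label `π₁ = ξ_v` of `i_H(χ_H)` has normalised Jacquet exponent `wχ_H`, so on a shell `Tr St_H(ξ_v) = Tr i_H(χ_H) − ξ_v` keeps exactly the `χ_H`-exponent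
# [Rogawski1990, §12.1 case (1) pp. 171–172; §12.7 L. 12.7.3 p. 195; §13.3 p. 202] [Casselman1995, L. 7.1.1 (a)]

Cell `pub/hodgecm-mathlib`, crux H413 = `stmt-HodgeConjecture-24833` (lane `--supports … --as helper`), route HCCMUnconditional; seat LH6-p02 (g2); road (D) owner
LH6-p03 (g0), ROAD-D v6 `F0/P3b/LH6-p03/g0/ROAD-D.status.v6.txt` (ee6dbfab) «Lean pieces (δ₁)(δ₂)(δ₃) → LH6-p02»; census `F0/P3b/LH6-p02/g2/CENSUS-VALUE-IDENTITY.v1.md`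
(138ccaff) §3 (R2).  (δ₁) `τ_v = μ_v(d′₀)` and (δ₃) `χ_{H,2}·ψdet·τ_v = χ_ξ∘ι_v` are ALREADY ★ — `F0P3bInducedCharTransferLeviDictionary.finTau_eq_finHeckeValue_of_levi` ∕
`torusCharPair_mul_localDet_mul_finTau_eq_cmXiTorusChar` (F0P3b-p01, (L2)) — so this file types only (δ₂).  THEOREMS ONLY, sorry-free, ★-only imports; no definition ∕
instance ∕ notation ∕ named fact.  HONEST LABEL: HC_CM is proved only modulo the 7 printed citations (2 remaining: hLiu418 = stmt-HodgeConjecture-24832, h413 =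
stmt-HodgeConjecture-24833) until rung 0 closes; count-neutral (D-c) bookkeeping, closes nothing by itself.

THE MATHEMATICS.  `H_v = U(Φ₂)(L⁺_v) × U(Φ₁)(L⁺_v)`, `ξ = (η, ψ)` one-dimensional, `ξ_v(h₂, h₁) = η_v(det h₂)·ψ_v(det h₂ · det h₁)` (★ `xiLocalChar_apply_eq`).  The organs'
`H`-side torus character is `χ_{H,2} = (η̃_v·‖·‖^{1∕2}, ψ_v)` on `T₂` (`η̃ = η∘quotConj`, coordinate `0`) times `ψ_v∘det` on `U(Φ₁)`; its Weyl conjugate is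
`wχ_{H,2} = (η̃_v·‖·‖^{-1∕2}, ψ_v)` (★ `weylTorusCharPair`: `(χ̄₁⁻¹, χ₂)`; `η̃(σα) = η̃(α)⁻¹` ★ `quotConj_units_map`, `‖σα‖ = ‖α‖` ★ `halfModulusChar_units_map_of_involutive`).
For `b = diag(α, σ(α)⁻¹) ∈ T₂` (torus relation ★ `LineRing.torus_relations_two`): `det b = α·σ(α)⁻¹ = quotConj(α)` (`localDet_eq_torusDetNormOne`, `quotConj_torusEntry_eq`),
`δ_{B₂}^{1∕2}(b) = ‖α‖^{1∕2}` (★ `rootDeltaChar_cmBorel_torus_two`), hence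
  **`ξ_v(b, z₁) = ψ_v(det z₁) · δ_{B₂}^{1∕2}(b) · wχ_{H,2}(b)`**  (`xiLocalChar_eq_psi_mul_rootDeltaChar_mul_weyl`)
— `ξ_v` restricted to `T_H` IS the un-normalised exponent `δ^{1∕2}·wχ_H` of the one-dimensional constituent, so in `Tr πSt(𝟙_{K_H (b,z₁) K_H}) = Tr i_H(χ_H)(𝟙) − ξ_v(𝟙)`
(★ HSt + ★ F1-H: `… ψdet(z₁)·δ^{1∕2}(b)·(χ_H(b) + wχ_H(b)) − … ξ_v(b, z₁)`) the `wχ_H`-term cancels: **`xi_kill`** (the scalar identity the (D-c) assembler `traceSum_eq_valueG` rewrites with).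

## References
* [Rogawski1990] J. D. Rogawski, *Automorphic Representations of Unitary Groups in Three Variables*, Ann. of Math. Stud. 123 (1990): §12.1 case (1) pp. 171–172
  (`JH(i_H(χ)) = {ξ, St_H(ξ)}`); §12.2 p. 173 (`w(χ₁, χ₂) = (χ̄₁⁻¹, χ₂)`); §12.7 Lemma 12.7.3 p. 195; §13.3 p. 202 (`ξ_v`).
* [Casselman1995] W. Casselman, *Introduction to the theory of admissible representations of p-adic reductive groups* (1995), Lemma 7.1.1 (a), §6.3.
-/

set_option autoImplicit false
-- the mandated namespace has the single-problem summit's repeated segment (`HodgeConjecture.HodgeConjecture`)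
set_option linter.dupNamespace false

noncomputable section

open NumberField IsDedekindDomain
open scoped Matrix MatrixGroups
open Literature.NumberTheory.Rogawski1990 Literature.NumberTheory.Automorphic Literature.NumberTheory.Automorphic.UnitaryGroup
open Literature.NumberTheory.GaloisRepresentations
open Summit.HodgeConjecture.HodgeConjecture.Cruxes.H413.F0P2oK1wOfWeylConj

namespace Summit.HodgeConjecture.HodgeConjecture.Cruxes.H413.F0P3cStCharTSXiOnTorus

variable (L : Type) [Field L] [NumberField L] [IsCMField L] (v : HeightOneSpectrum (𝓞 ↥(maximalRealSubfield L)))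

/-! ## §1 The determinant and the quotient-by-conjugate on the rank-one torus `T₂ = {diag(α, σ(α)⁻¹)}` -/

/-- **`det b = torusDetNormOne b`** for `b ∈ T₂ ≤ U(Φ₂)(L⁺_v)`: the `E¹_v`-valued determinant ★ `localDet` of the organs and the torus determinant ★ `torusDetNormOne`
are the same element of `E¹_v` (both have underlying unit `det b`). [cite: Rogawski1990, §12.1 p. 171; §3.13] -/
theorem localDet_eq_torusDetNormOne
    (b : ↥(unitaryGroupOfForm (conjLocal L (IsCMField.complexConj L) v) (cmLocalForm L 2 v))) (hbM : b ∈ (cmBorelTriple L 2 v).M) :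
    localDet (IsCMField.complexConj L) v (isUnit_antidiagOne_det L 2) b =
      torusDetNormOne (conjLocal L (IsCMField.complexConj L) v) (cmLocalForm L 2 v) (cmLocalForm_eq_over L 2 v) ⟨b, hbM⟩ :=
  Subtype.ext rfl

/-- **`det diag(α, σ(α)⁻¹) = α·σ(α)⁻¹ = quotConj α`** in `E¹_v` (torus relation `σ(d₀)·d₁ = 1`, ★ `LineRing.torus_relations_two`).
[cite: Rogawski1990, §12.1 p. 171] -/
theorem quotConj_torusEntry_eq_torusDetNormOne (t : ↥(cmBorelTriple L 2 v).M) :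
    quotConj (conjLocal L (IsCMField.complexConj L) v) (conjLocal_conjLocal_cm L v)
        (torusEntry (conjLocal L (IsCMField.complexConj L) v) (cmLocalForm L 2 v) 0 t) =
      torusDetNormOne (conjLocal L (IsCMField.complexConj L) v) (cmLocalForm L 2 v) (cmLocalForm_eq_over L 2 v) t := by
  obtain ⟨d, hd⟩ := (mem_torusU_iff _).1 t.2
  obtain ⟨-, h01⟩ := LineRing.torus_relations_two (conjLocal L (IsCMField.complexConj L) v) (cmLocalForm_eq_over L 2 v) t hd
  -- `(σ d₀)⁻¹ = d₁` as units
  have hinv : (Units.map ((conjLocal L (IsCMField.complexConj L) v : LocalRing L v →+* LocalRing L v) : LocalRing L v →* LocalRing L v) (d 0))⁻¹ = d 1 :=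
    inv_eq_of_mul_eq_one_right (Units.ext (by rw [Units.val_mul, Units.coe_map, MonoidHom.coe_coe, Units.val_one]; exact h01))
  refine Subtype.ext ?_
  rw [coe_quotConj, coe_torusDetNormOne, torusEntry_eq_of_glDiagonal_eq _ _ 0 t d hd, torusDet_eq_of_glDiagonal_eq _ _ t d hd,
    Fin.prod_univ_two, hinv]

/-! ## §2 (δ₂) `ξ_v = ψ_v∘det · δ_{B₂}^{1∕2} · wχ_{H,2}` on `T_H = T₂ × U(Φ₁)(L⁺_v)` -/

set_option maxHeartbeats 1600000 in  -- statement-level `whnf` on the CM carriers `(cmDatum …).Local v` (measured class, cf. ★ F1-H ∕ ★ (D-b))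
/-- **(δ₂) «XI-ON-TORUS»: `ξ_v(b, z₁) = ψ_v(det z₁) · δ_{B₂}^{1∕2}(b) · wχ_{H,2}(b)`** for `b ∈ T₂`, `z₁ ∈ U(Φ₁)(L⁺_v)`, where `χ_{H,2} = torusCharPair … 0 (η̃_v·‖·‖^{1∕2}) ψ_v` is
the organs' `H`-side label character and `wχ_{H,2} = weylTorusCharPair … 0 (η̃_v·‖·‖^{1∕2}) ψ_v` its Weyl conjugate (the Jacquet exponent of the one-dimensional constituent
`π₁ = ξ_v` of `i_H(χ_H)`); `δ_{B₂}^{1∕2}` in the `Subgroup.inclusion M_le ⟨b, hbM⟩` spelling of ★ F1-H.  Both sides are `η̃_v(α)·ψ_v(det b)·ψ_v(det z₁)` at `b = diag(α, σ(α)⁻¹)`.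
[cite: Rogawski1990, §12.1 case (1) pp. 171–172; §12.2 p. 173; §13.3 p. 202] [cite: Casselman1995, Lemma 7.1.1 (a)] -/
theorem xiLocalChar_eq_psi_mul_rootDeltaChar_mul_weyl (ξ : OneDimAutRepH L)
    (b : ↥(unitaryGroupOfForm (conjLocal L (IsCMField.complexConj L) v) (cmLocalForm L 2 v))) (hbM : b ∈ (cmBorelTriple L 2 v).M)
    (z₁ : (cmDatum L 1 (Matrix.of fun i j : Fin 1 => if i.val + j.val + 1 = 1 then (1 : L) else 0)).Local v) :
    haveI := locallyCompactSpace_cmBorelU L 2 v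
    ξ.xiLocalChar v ((b, z₁) : ↥(unitaryGroupOfForm (conjLocal L (IsCMField.complexConj L) v) (cmLocalForm L 2 v)) ×
        (cmDatum L 1 (Matrix.of fun i j : Fin 1 => if i.val + j.val + 1 = 1 then (1 : L) else 0)).Local v) =
      (torusLocalComponent L (IsCMField.complexConj L) v ξ.ψ).comp (localDet (IsCMField.complexConj L) v (isUnit_antidiagOne_det L 1)) z₁ *
        rootDeltaChar (cmBorelTriple L 2 v).P (Subgroup.inclusion (cmBorelTriple L 2 v).M_le ⟨b, hbM⟩) *
        weylTorusCharPair (conjLocal L (IsCMField.complexConj L) v) (cmLocalForm L 2 v) (cmLocalForm_eq_over L 2 v) 0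
          ((torusLocalComponent L (IsCMField.complexConj L) v ξ.η).comp
              (quotConj (conjLocal L (IsCMField.complexConj L) v) (conjLocal_conjLocal_cm L v)) *
            halfModulusChar (UnitaryGroup.LocalRing L v))
          (torusLocalComponent L (IsCMField.complexConj L) v ξ.ψ) ⟨b, hbM⟩ := by
  haveI := locallyCompactSpace_cmBorelU L 2 v
  -- atoms: `E0 = α = b₀₀`, `DN = det b ∈ E¹_v`, `(localDet (IsCMField.complexConj L) v (isUnit_antidiagOne_det L 1) z₁) = det z₁ ∈ E¹_v`
  set E0 := torusEntry (conjLocal L (IsCMField.complexConj L) v) (cmLocalForm L 2 v) 0 ⟨b, hbM⟩ with hE0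
  set DN := torusDetNormOne (conjLocal L (IsCMField.complexConj L) v) (cmLocalForm L 2 v) (cmLocalForm_eq_over L 2 v) ⟨b, hbM⟩ with hDN
  -- `δ_{B₂}^{1∕2}(b) = ‖α‖^{1∕2}` (★; the `Subgroup.inclusion` spelling of F1-H is the ★ spelling by `rfl`)
  have hδ : rootDeltaChar (cmBorelTriple L 2 v).P (Subgroup.inclusion (cmBorelTriple L 2 v).M_le ⟨b, hbM⟩) = halfModulusChar (LocalRing L v) E0 :=
    rootDeltaChar_cmBorel_torus_two L v ⟨b, hbM⟩
  -- `det b = DN` (same element of `E¹_v`), `quotConj (σ α) = DN⁻¹`, `‖σ α‖^{1∕2} = ‖α‖^{1∕2}`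
  have h1 : localDet (IsCMField.complexConj L) v (isUnit_antidiagOne_det L 2)
      (((b, z₁) : ↥(unitaryGroupOfForm (conjLocal L (IsCMField.complexConj L) v) (cmLocalForm L 2 v)) ×
        (cmDatum L 1 (Matrix.of fun i j : Fin 1 => if i.val + j.val + 1 = 1 then (1 : L) else 0)).Local v).1) = DN :=
    localDet_eq_torusDetNormOne L v b hbM
  have hq : quotConj (conjLocal L (IsCMField.complexConj L) v) (conjLocal_conjLocal_cm L v) (Units.map ((conjLocal L (IsCMField.complexConj L) v : LocalRing L v →+* LocalRing L v) : LocalRing L v →* LocalRing L v) E0) = DN⁻¹ := by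
    rw [quotConj_units_map, hE0, quotConj_torusEntry_eq_torusDetNormOne]
  have hh : halfModulusChar (LocalRing L v) (Units.map ((conjLocal L (IsCMField.complexConj L) v : LocalRing L v →+* LocalRing L v) : LocalRing L v →* LocalRing L v) E0) = halfModulusChar (LocalRing L v) E0 :=
    halfModulusChar_units_map_of_involutive (conjLocal L (IsCMField.complexConj L) v) (continuous_conjLocal L (IsCMField.complexConj L) v) (conjLocal_conjLocal_cm L v) E0
  -- the left side in atoms
  have L1 : ξ.xiLocalChar v ((b, z₁) : ↥(unitaryGroupOfForm (conjLocal L (IsCMField.complexConj L) v) (cmLocalForm L 2 v)) ×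
        (cmDatum L 1 (Matrix.of fun i j : Fin 1 => if i.val + j.val + 1 = 1 then (1 : L) else 0)).Local v) =
      torusLocalComponent L (IsCMField.complexConj L) v ξ.η DN *
        (torusLocalComponent L (IsCMField.complexConj L) v ξ.ψ DN * torusLocalComponent L (IsCMField.complexConj L) v ξ.ψ (localDet (IsCMField.complexConj L) v (isUnit_antidiagOne_det L 1) z₁)) := by
    rw [OneDimAutRepH.xiLocalChar_apply_eq, h1, map_mul]
  -- the Weyl-conjugate character in atoms (`weylTorusCharPair_apply` ∕ `conjInvChar_apply` are `rfl`)
  have e1 : ((torusLocalComponent L (IsCMField.complexConj L) v ξ.η).comp (quotConj (conjLocal L (IsCMField.complexConj L) v) (conjLocal_conjLocal_cm L v)) *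
            halfModulusChar (UnitaryGroup.LocalRing L v)) (Units.map ((conjLocal L (IsCMField.complexConj L) v : LocalRing L v →+* LocalRing L v) : LocalRing L v →* LocalRing L v) E0) =
      (torusLocalComponent L (IsCMField.complexConj L) v ξ.η DN)⁻¹ * halfModulusChar (LocalRing L v) E0 := by
    rw [MonoidHom.mul_apply, MonoidHom.comp_apply, hq, map_inv, hh]
  have R1 : weylTorusCharPair (conjLocal L (IsCMField.complexConj L) v) (cmLocalForm L 2 v) (cmLocalForm_eq_over L 2 v) 0
          ((torusLocalComponent L (IsCMField.complexConj L) v ξ.η).comp (quotConj (conjLocal L (IsCMField.complexConj L) v) (conjLocal_conjLocal_cm L v)) *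
            halfModulusChar (UnitaryGroup.LocalRing L v))
          (torusLocalComponent L (IsCMField.complexConj L) v ξ.ψ) ⟨b, hbM⟩ =
      ((torusLocalComponent L (IsCMField.complexConj L) v ξ.η DN)⁻¹ * halfModulusChar (LocalRing L v) E0)⁻¹ *
        torusLocalComponent L (IsCMField.complexConj L) v ξ.ψ DN := by
    show (((torusLocalComponent L (IsCMField.complexConj L) v ξ.η).comp (quotConj (conjLocal L (IsCMField.complexConj L) v) (conjLocal_conjLocal_cm L v)) *
            halfModulusChar (UnitaryGroup.LocalRing L v)) (Units.map ((conjLocal L (IsCMField.complexConj L) v : LocalRing L v →+* LocalRing L v) : LocalRing L v →* LocalRing L v) E0))⁻¹ *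
        torusLocalComponent L (IsCMField.complexConj L) v ξ.ψ DN = _
    rw [e1]
  have e2 : ((torusLocalComponent L (IsCMField.complexConj L) v ξ.ψ).comp (localDet (IsCMField.complexConj L) v (isUnit_antidiagOne_det L 1))) z₁ =
      torusLocalComponent L (IsCMField.complexConj L) v ξ.ψ (localDet (IsCMField.complexConj L) v (isUnit_antidiagOne_det L 1) z₁) :=
    MonoidHom.comp_apply _ _ _
  rw [L1, R1, hδ, e2, mul_inv_rev, inv_inv]
  -- abelian-group bookkeeping in `ℂˣ`: `A·(P·Z) = Z·H·(H⁻¹·A·P)`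
  set A := torusLocalComponent L (IsCMField.complexConj L) v ξ.η DN
  set P := torusLocalComponent L (IsCMField.complexConj L) v ξ.ψ DN
  set ZZ := torusLocalComponent L (IsCMField.complexConj L) v ξ.ψ (localDet (IsCMField.complexConj L) v (isUnit_antidiagOne_det L 1) z₁)
  set H := halfModulusChar (LocalRing L v) E0
  calc A * (P * ZZ) = ZZ * (H * H⁻¹) * (A * P) := by rw [mul_inv_cancel, mul_one, mul_comm ZZ, mul_assoc]
    _ = ZZ * H * (H⁻¹ * A * P) := by simp only [mul_assoc]

set_option maxHeartbeats 1600000 in  -- same carriers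
/-- **The kill identity in `ℂ`** (the shape the (D-c) assembler rewrites with): for `b ∈ T₂`, `z₁ ∈ U(Φ₁)(L⁺_v)` and ANY scalars `V` (= `ν₂(K₂)·#R₂·ν₁(K₁)`),
`V·ψdet(z₁)·δ^{1∕2}(b)·(χ_{H,2}(b) + wχ_{H,2}(b)) − V·ξ_v(b, z₁) = V·ψdet(z₁)·δ^{1∕2}(b)·χ_{H,2}(b)` — ★ HSt's `Tr πSt = Tr i_H(χ_H) − ξ_v` read on a shell through ★ F1-H keeps
exactly the `χ_H`-exponent. [cite: Rogawski1990, §12.1 case (1) pp. 171–172; §12.7 Lemma 12.7.3 p. 195] [cite: Casselman1995, Lemma 7.1.1 (a)] -/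
theorem xi_kill (ξ : OneDimAutRepH L)
    (b : ↥(unitaryGroupOfForm (conjLocal L (IsCMField.complexConj L) v) (cmLocalForm L 2 v))) (hbM : b ∈ (cmBorelTriple L 2 v).M)
    (z₁ : (cmDatum L 1 (Matrix.of fun i j : Fin 1 => if i.val + j.val + 1 = 1 then (1 : L) else 0)).Local v) (V : ℂ) :
    haveI := locallyCompactSpace_cmBorelU L 2 v
    V * ((((torusLocalComponent L (IsCMField.complexConj L) v ξ.ψ).comp (localDet (IsCMField.complexConj L) v (isUnit_antidiagOne_det L 1)) z₁ : ℂˣ) : ℂ) *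
        ((rootDeltaChar (cmBorelTriple L 2 v).P (Subgroup.inclusion (cmBorelTriple L 2 v).M_le ⟨b, hbM⟩) : ℂˣ) : ℂ) *
        (((torusCharPair (conjLocal L (IsCMField.complexConj L) v) (cmLocalForm L 2 v) (cmLocalForm_eq_over L 2 v) 0
              ((torusLocalComponent L (IsCMField.complexConj L) v ξ.η).comp
                  (quotConj (conjLocal L (IsCMField.complexConj L) v) (conjLocal_conjLocal_cm L v)) *
                halfModulusChar (UnitaryGroup.LocalRing L v))
              (torusLocalComponent L (IsCMField.complexConj L) v ξ.ψ) ⟨b, hbM⟩ : ℂˣ) : ℂ) +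
          ((weylTorusCharPair (conjLocal L (IsCMField.complexConj L) v) (cmLocalForm L 2 v) (cmLocalForm_eq_over L 2 v) 0
              ((torusLocalComponent L (IsCMField.complexConj L) v ξ.η).comp
                  (quotConj (conjLocal L (IsCMField.complexConj L) v) (conjLocal_conjLocal_cm L v)) *
                halfModulusChar (UnitaryGroup.LocalRing L v))
              (torusLocalComponent L (IsCMField.complexConj L) v ξ.ψ) ⟨b, hbM⟩ : ℂˣ) : ℂ))) -
      V * ((ξ.xiLocalChar v ((b, z₁) : ↥(unitaryGroupOfForm (conjLocal L (IsCMField.complexConj L) v) (cmLocalForm L 2 v)) ×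
        (cmDatum L 1 (Matrix.of fun i j : Fin 1 => if i.val + j.val + 1 = 1 then (1 : L) else 0)).Local v) : ℂˣ) : ℂ) =
    V * ((((torusLocalComponent L (IsCMField.complexConj L) v ξ.ψ).comp (localDet (IsCMField.complexConj L) v (isUnit_antidiagOne_det L 1)) z₁ : ℂˣ) : ℂ) *
        ((rootDeltaChar (cmBorelTriple L 2 v).P (Subgroup.inclusion (cmBorelTriple L 2 v).M_le ⟨b, hbM⟩) : ℂˣ) : ℂ) *
        ((torusCharPair (conjLocal L (IsCMField.complexConj L) v) (cmLocalForm L 2 v) (cmLocalForm_eq_over L 2 v) 0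
              ((torusLocalComponent L (IsCMField.complexConj L) v ξ.η).comp
                  (quotConj (conjLocal L (IsCMField.complexConj L) v) (conjLocal_conjLocal_cm L v)) *
                halfModulusChar (UnitaryGroup.LocalRing L v))
              (torusLocalComponent L (IsCMField.complexConj L) v ξ.ψ) ⟨b, hbM⟩ : ℂˣ) : ℂ)) := by
  rw [xiLocalChar_eq_psi_mul_rootDeltaChar_mul_weyl L v ξ b hbM z₁]
  push_cast
  ring

end Summit.HodgeConjecture.HodgeConjecture.Cruxes.H413.F0P3cStCharTSXiOnTorus

end
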